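import Summits.BirchSwinnertonDyer.BirchSwinnertonDyer.Theorems.PrintCf2RamifiedJumpOneTwoDividesOfWitness
import HarnessLib

/-!
# Crux workfile (LEAD cruxlead-20509 g24, lineage cycle 25): the LEAD's PROPOSED RE-CUT of the crux-plan line `cassels-tate-entries`
# on C⁺ = item stmt-BirchSwinnertonDyer-23431 `PrintCf2.RamifiedJumpOneLevelTwoOfFacts` — WITH THE NAMED FACTS, and with the lower half
# split into its LANDED non-silent part (p782512) and its OPEN silent-stratum residual

Host crux: stmt-BirchSwinnertonDyer-20509 `PrintCf2.RamifiedOffTYZOfFacts`, line `offtyz-v7` (registry v9: C⁺ = `stub_offTYZ_levelTwoScriptLExact`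
= item 23431 by name).  This file is EVIDENCE for the pen / the cruxplan seat of 23431 (only units named for 23431 may register there); it
ELABORATES against the tree, `sorry` exactly in the three `stub_*` theorems, and its composition `RamifiedJumpOneLevelTwoOfFacts_of` proves item
23431 BY NAME modulo the stubs.  Nothing is asserted; BSD is not proved by any of this; 23431 / 20509 stay OPEN.

## Why a re-cut (the grade of the registered line, LEAD cycle 25)

The registered skeleton `Cruxes/RamifiedJumpOneLevelTwoOfFacts/Lines/cassels_tate_entries.lean` (2026-08-30T17:27Z) has two stubs
`stub_TwoDividesScriptL` / `stub_NotFourDividesScriptL`, both FACT-FREE (no GZK, no TYZ §3 display among their binders) and stub 1 sized «M,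
applying print».  Against the lineage's kernel record:
* every lower-half and upper-half theorem of the 166 `Theorems/PrintCf2RamifiedOffTYZ*.lean` files is CONDITIONAL on the TYZ §3 display packages
  (`tyz_cmPoint…Data`), Thm. 1.1 (`thm11_parity_of_scriptL`) and GZK (`rank_eq_analyticRank_of_analyticRank_le_one`) — none has `_holds`; so a
  fact-free stub can never receive a `--supports 23431` landing by these methods (nor by any other: `analyticRank = 1` is not decidable in-tree
  for a single `n` without the L-function facts);
* `2 ∣ 𝓛(n)` is NOT Thm. 1.2 (one-directional: `2^{−ρ}𝓛` even ⟹ genus sums even); it is proved — granted the bundle — exactly OFF the silent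
  stratum (tree `LowerHalfByName.twoDivides_of_point_of_facts`, p782512: one rational point with abscissa outside `⟨−1, 2, n⟩·ℚ^{×2}` suffices, all
  residues, all `k`), and ON the silent stratum (odd: `ρ(n) = 0`; block-free: descent class `d(h) = 2` of the `A_n`-generator; POPULATED in the
  jump-one class: R2 ∩ G rows 959, 4223, 7903, 7967, 8119, 9407 of `Lines/offtyz_v7_GenusPeriodBit.md`) it is the `2`-divisibility of TYZ's genus
  point `P(n)` in `A(ℍ′_n)` modulo torsion (`[α_n] = 0` there, g18 `InvisibleGenerator`) — research, same grade as the upper half.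
Hence the cut below: ONE print leaf (the bundle, width 0 like the six door leaves of offtyz-v7), the silent-stratum lower half (research, L),
the upper half (research, L–XL; the line card's (E)(S)(G)(I) decomposition applies to it unchanged), composed through p782512's
`ramifiedJumpOneLevelTwoOfFacts_of_facts_of_silentStratum_of_upper`.  A line on 23431 that keeps fact-free stubs is not landable piecewise.

References: [cite: TianYuanZhang2017, Thm. 1.1, Thm. 1.2, Thm. 3.5, Remark 1.3]; [cite: Darmon2004, Thm. 3.22]; tree p782512
`Theorems/PrintCf2RamifiedJumpOneTwoDividesOfWitness.lean`; crux workfiles `Lines/offtyz_v7_GenusPeriodBit.md`, `Lines/offtyz_v7_RigidityAndUnits.md`.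
-/

noncomputable section

open Literature.NumberTheory.EllipticCurves Literature.NumberTheory.EllipticCurves.TianYuanZhang2017
  Summit.BirchSwinnertonDyer.BirchSwinnertonDyer.Theses.PrintCf2 Summit.BirchSwinnertonDyer.PrintCf2

set_option autoImplicit false
set_option linter.dupNamespace false

namespace Summit.BirchSwinnertonDyer.BirchSwinnertonDyer.Cruxes.RamifiedOffTYZOfFacts.LowerHalfByNameRecut

/-- STUB 1 (PRINT LEAF, width 0): the named-fact bundle — TYZ 2017 §3 displays incl. the CM-point layer and the compositum sentence
(`tyz_cmPointCompositumData`, refines every earlier `tyz_cmPoint…Data`), TYZ Thm. 1.1 (`thm11_parity_of_scriptL`), Gross–Zagier–Kolyvagin.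
Closable only by `_holds` for the three prints (not expected); the route books such leaves as print IOUs.
[cite: TianYuanZhang2017, §3, Thm. 1.1] [cite: Darmon2004, Thm. 3.22] -/
theorem stub_printFacts :
    tyz_cmPointCompositumData ∧ thm11_parity_of_scriptL ∧ rank_eq_analyticRank_of_analyticRank_le_one := by
  sorry

/-- STUB 2 (RESEARCH, L): **the lower half on the SILENT stratum**, granted the bundle — for square-free `n ≡ 5, 6, 7 (mod 8)` in the jump-one
class ALL of whose rational points have abscissa in `⟨−1, 2, n⟩·ℚ^{×2}` (odd `n`: `ρ(n) = 0`), `2 ∣ L` whenever `𝓛(n)² = L²`.  Content: TYZ's genus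
point `P(n)` is `2`-divisible in `A(ℍ′_n)` modulo torsion on that stratum (`[α_n] = 0` there).  No printed lever (TYZ stop at `mod 2`); inputs
named by the lineage: (U1) `x, x ∓ 2i, y` as eta or Klein-form quotients on `X₀(32)`, (U2) Shimura reciprocity for their CM values, (U3) the genus
Kronecker limit formula at level 32 (`Lines/offtyz_v7_RigidityAndUnits.md` §4).  Why it might fail: it is an instance of BSD(E_n, 2) (B-members
of the `#Sel₂ = 2⁵` class also satisfy it, so no Selmer obstruction exists; failure = a BSD₂ counterexample).
[cite: TianYuanZhang2017, Thm. 3.5, Remark 1.3] -/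
theorem stub_silentTwoDivides :
    (tyz_cmPointCompositumData ∧ thm11_parity_of_scriptL ∧ rank_eq_analyticRank_of_analyticRank_le_one) →
    ∀ (n : ℕ) [(congruentNumberCurve n).IsElliptic] [(congruentNumberCurve n).IsGloballyMinimal],
      Squarefree n → (n % 8 = 5 ∨ n % 8 = 6 ∨ n % 8 = 7) → (congruentNumberCurve n).analyticRank = 1 →
      Nat.card ((congruentNumberCurve n).selmerGroup 2) = 2 ^ 5 → Nat.card ((congruentNumberCurve n).selmerGroup 4) = 2 ^ 6 →
      (∀ x₀ y₀ : ℚ, (congruentNumberCurve n).toAffine.Nonsingular x₀ y₀ →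
        ∃ q : ℚ, x₀ = q ^ 2 ∨ x₀ = -q ^ 2 ∨ x₀ = n * q ^ 2 ∨ x₀ = -(n * q ^ 2) ∨
          x₀ = 2 * q ^ 2 ∨ x₀ = -(2 * q ^ 2) ∨ x₀ = 2 * n * q ^ 2 ∨ x₀ = -(2 * n * q ^ 2)) →
      ∀ L : ℤ, IsScriptL n L → (2 : ℤ) ∣ L := by
  sorry

/-- STUB 3 (RESEARCH, L–XL): **the upper half**, granted the bundle — on the jump-one class `¬ 4 ∣ L` whenever `𝓛(n)² = L²`.  By the displays:
⟺ `P(n) ∉ A(K_n)⁻ + A[4]` on `{ρ = 1}` (Thm. 3.5 "i.e."), ⟺ `P(n) ∉ 2ℤα_n + A(ℍ′_n)_tor` on `{ρ = 0}` — the EXACT non-divisibility of the genus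
point; the line card's (E) CT dichotomy + pin (p776422/p778607), (S) Cassels symbols (p779369), (G) halving Bockstein (p776841 §0) and (I) the
three entry laws (partner / Scholz in print; top-period = research) decompose THIS stub.  Why it might fail: = BSD(E_n, 2)'s upper bound on the
class (p770400); no printed lever.
[cite: TianYuanZhang2017, Thm. 3.5, Remark 1.3] -/
theorem stub_notFourDivides :
    (tyz_cmPointCompositumData ∧ thm11_parity_of_scriptL ∧ rank_eq_analyticRank_of_analyticRank_le_one) →
    ∀ (n : ℕ) [(congruentNumberCurve n).IsElliptic] [(congruentNumberCurve n).IsGloballyMinimal],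
      Squarefree n → (n % 8 = 5 ∨ n % 8 = 6 ∨ n % 8 = 7) → (congruentNumberCurve n).analyticRank = 1 →
      Nat.card ((congruentNumberCurve n).selmerGroup 2) = 2 ^ 5 → Nat.card ((congruentNumberCurve n).selmerGroup 4) = 2 ^ 6 →
      ∀ L : ℤ, IsScriptL n L → ¬ (4 : ℤ) ∣ L := by
  sorry

/-- COMPOSITION (real proof, kernel-checked modulo the three stubs): item 23431 BY NAME, through p782512's
`LowerHalfByName.ramifiedJumpOneLevelTwoOfFacts_of_facts_of_silentStratum_of_upper` (the non-silent lower half is the LANDED theorem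
`LowerHalfByName.twoDivides_of_point_of_facts` inside it). [cite: TianYuanZhang2017, Thm. 1.1, Thm. 3.5] [cite: Darmon2004, Thm. 3.22] -/
theorem RamifiedJumpOneLevelTwoOfFacts_of : RamifiedJumpOneLevelTwoOfFacts :=
  LowerHalfByName.ramifiedJumpOneLevelTwoOfFacts_of_facts_of_silentStratum_of_upper stub_printFacts
    (stub_silentTwoDivides stub_printFacts) (stub_notFourDivides stub_printFacts)

end Summit.BirchSwinnertonDyer.BirchSwinnertonDyer.Cruxes.RamifiedOffTYZOfFacts.LowerHalfByNameRecut

end
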